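import Summits.HodgeConjecture.CorCM.Census.OcticTwistResidualSlices
import Summits.HodgeConjecture.CorCM.Census.OcticTwistResidualCC
import Summits.HodgeConjecture.CorCM.Census.OcticTwistResidualBlocks

/-!
# The octic twist `(ℤ/8 × B, (4,0))`, IX: THE OCTIC RESIDUAL THEOREM — a Hodge vector on the residual pair types is octic pairs plus
# motions of `X ⊗ cst`, `w ⊗ cst` and the D-moves

COR-CM (cell `pub-hodgecm2`), count-neutral kernel combinatorics by the binder seat b09 (gen 33; lane COINVARIANT-TWIST / OCTIC RECON, design
step 3 of `HOME/pub-hodgecm2-b09/lean-g33/COINVARIANT-TWIST.md` PART C), on top of parts I–VIII (`Census/OcticTwist*.lean`: `pot`,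
`exists_of_pot_le_one`, `cstSupp`, `gather₀/₁_mem`, `slice₀/₁_mem`, `ccSquare_mem`, `ccSquare₀_mem`, **`cc_mem`**) and the quartic residual
vectors (`Census/QuarticTwistResidual.lean`: `Xvec`, `Wvec`, `IsRes1`, `cst_eq_cst_iff`) used BY NAME.  Theorems only; no `decide` beyond closed
numerals of `ZMod 4`, no certificate, no named fact, no `sorry`.  HONEST FRAMING: `HC_CM` is NOT proved; nothing here is a period or a headline.

THE THEOREM (`residual₂_mem`, `|B| ≥ 3`, `B` any finite group).  Let `N₂ ≤ hodge₂` be a submodule containing the octic pairs, the LIFTS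
`X_{u,b} ⊗ e_{cst u′}`, `e_{cst u′} ⊗ X_{u,b}`, `w_u ⊗ e_{cst u′}`, `e_{cst u′} ⊗ w_u`, and the D-MOVES `(e_{u+kδ_b} − e_u) ⊗ (e_{cst u′} − e_{cst u″})`,
`(e_{cst u′} − e_{cst u″}) ⊗ (e_{u+kδ_b} − e_u)` (`k = ±1`).  Then **every octic Hodge vector supported on the pair types of potential `≤ 1` lies
in `N₂`** — the kernel form of the lane noteʼs FACT 3 (numerically: rank `28|B| + 8`, these generators span with index `1`,
`B = ℤ/3, ℤ/4, ℤ/2², ℤ/5`).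
PROOF (`M := N₂ ⊔ cstSupp`).  Split `r = R₀ + R₁` into the entries with constant first coordinate and the atom-first entries (whose second
coordinates are constant, `exists_of_pot_le_one`).  The rows of `R₁` at `cst u` are gathered to `cst 0` by part VIII (`gather₀_mem`) and sum
to `marg₀ r − marg₀ R₀`, a quartic Hodge vector on the small residual types minus a constant vector; `slice₀_mem` puts `(marg₀ r) ⊗ e_{cst 0}`
in `M`, so `R₁ ∈ M`.  The columns of `R₀` likewise with `marg₁` (`gather₁_mem`, `slice₁_mem`).  Hence `r = n + c` with `n ∈ N₂` and `c`
supported on the constant-constant types; `c = r − n` is Hodge (`N₂ ≤ hodge₂`), and `cc_mem` (part VII; the squares from `ccSquare₀_mem`, i.e.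
from the Weil lifts and the D-moves) puts `c` in `N₂`.
WHAT REMAINS for `μ(ℤ/8 × B) = β − 1` (successor; lane note PART C steps 4–5): nine CLOSING FACES whose motions supply the lifts and the
D-moves modulo `pairs₂ ⊔ spanMot(S ∪ closing)` (`S` the covering family of part IV), then the count `|S ∪ closing| + 1 ≤ (β − 10) + 9 + 1 = β`
(`ten_le_card_residual_blocks`) and the floor `|S′| + 1 ≥ β` from `Census/CoinvariantTwistLaw.lean`.

## References
* [Pohlmann1968] H. Pohlmann, Algebraic cycles on abelian varieties of complex multiplication type, Ann. of Math. 88 (1968), Thm 1.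
-/

namespace Summit.HodgeConjecture.CorCM.Census.OcticTwist

open Finset
open Summit.HodgeConjecture.CorCM.Census.QuarticTwist

variable (B : Type) [AddGroup B] [Fintype B] [DecidableEq B]

/-! ## The assembly -/

omit [AddGroup B] in
/-- A sum over all types of a function vanishing off the constant types is the sum over the four constants. [folklore] -/
theorem sum_eq_sum_cst [Nonempty B] {M : Type} [AddCommMonoid M] (f : Ty B → M) (hf : ∀ t, (¬ ∃ u, t = cst B u) → f t = 0) :
    ∑ t, f t = ∑ u : ZMod 4, f (cst B u) := by
  classical
  obtain ⟨b₀⟩ := ‹Nonempty B›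
  have hinj : Set.InjOn (fun u : ZMod 4 => cst B u) ↑(univ : Finset (ZMod 4)) := fun u _ u' _ h => (cst_eq_cst_iff B b₀).mp h
  rw [← Finset.sum_image hinj]
  symm
  refine Finset.sum_subset (subset_univ _) fun t _ ht => hf t fun ⟨u, hu⟩ => ht ?_
  exact mem_image.mpr ⟨u, mem_univ u, hu.symm⟩

omit [AddGroup B] in
/-- **THE OCTIC RESIDUAL THEOREM** (`|B| ≥ 3`).  Let `N₂ ≤ hodge₂` contain the octic pairs, the lifts `X_{u,b} ⊗ e_{cst u′}`, `e_{cst u′} ⊗ X_{u,b}`,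
`w_u ⊗ e_{cst u′}`, `e_{cst u′} ⊗ w_u` and the D-moves in both coordinates.  Then every octic Hodge vector supported on the pair types of
potential `≤ 1` lies in `N₂`. [folklore] -/
theorem residual₂_mem (h3 : 3 ≤ Fintype.card B) {N₂ : Submodule ℤ (Ty₂ B → ℤ)} (hN : N₂ ≤ hodge₂ B) (hP : pairs₂ B ≤ N₂)
    (hX0 : ∀ (u : ZMod 4) (b : B) (u' : ZMod 4), tens B (Xvec B u b) (Pi.single (cst B u') 1) ∈ N₂)
    (hX1 : ∀ (u : ZMod 4) (b : B) (u' : ZMod 4), tens B (Pi.single (cst B u') 1) (Xvec B u b) ∈ N₂)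
    (hW0 : ∀ u u' : ZMod 4, tens B (Wvec B u) (Pi.single (cst B u') 1) ∈ N₂)
    (hW1 : ∀ u u' : ZMod 4, tens B (Pi.single (cst B u') 1) (Wvec B u) ∈ N₂)
    (hD0 : ∀ (u : ZMod 4) (b : B) (k : ZMod 4) (u' u'' : ZMod 4), (k = 1 ∨ k = -1) →
      tens B (Pi.single (atom B u b k) 1 - Pi.single (cst B u) 1) (Pi.single (cst B u') 1 - Pi.single (cst B u'') 1) ∈ N₂)
    (hD1 : ∀ (u : ZMod 4) (b : B) (k : ZMod 4) (u' u'' : ZMod 4), (k = 1 ∨ k = -1) →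
      tens B (Pi.single (cst B u') 1 - Pi.single (cst B u'') 1) (Pi.single (atom B u b k) 1 - Pi.single (cst B u) 1) ∈ N₂)
    {r : Ty₂ B → ℤ} (hr : r ∈ hodge₂ B) (hsupp : ∀ T, r T ≠ 0 → pot B T ≤ 1) : r ∈ N₂ := by
  classical
  haveI : Nonempty B := Fintype.card_pos_iff.mp (by omega)
  obtain ⟨b₀⟩ := ‹Nonempty B›
  -- shapes of the support
  have hshape : ∀ T, r T ≠ 0 → (IsRes1 B T.1 ∧ IsRes1 B T.2) ∧ ((∃ u, T.1 = cst B u) ∨ (∃ u, T.2 = cst B u)) := by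
    intro T hT
    rcases exists_of_pot_le_one B (hsupp T hT) with ⟨u, u', rfl⟩ | ⟨u, u', b, k, hk, h | h⟩
    · exact ⟨⟨⟨u, b₀, 0, Or.inl rfl, (atom_zero B u b₀).symm⟩, ⟨u', b₀, 0, Or.inl rfl, (atom_zero B u' b₀).symm⟩⟩, Or.inl ⟨u, rfl⟩⟩
    · rw [h]
      exact ⟨⟨⟨u, b₀, 0, Or.inl rfl, (atom_zero B u b₀).symm⟩, ⟨u', b, k, Or.inr hk, rfl⟩⟩, Or.inl ⟨u, rfl⟩⟩
    · rw [h]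
      exact ⟨⟨⟨u', b, k, Or.inr hk, rfl⟩, ⟨u, b₀, 0, Or.inl rfl, (atom_zero B u b₀).symm⟩⟩, Or.inr ⟨u, rfl⟩⟩
  -- split `r = R₀ + R₁`: constant first coordinate / atom first coordinate
  let R₁ : Ty₂ B → ℤ := fun T => if ∃ u, T.1 = cst B u then 0 else r T
  let R₀ : Ty₂ B → ℤ := r - R₁
  have hR₀ : ∀ T, R₀ T ≠ 0 → ∃ u, T.1 = cst B u := by
    intro T hT
    by_contra h
    apply hT
    show r T - (if ∃ u, T.1 = cst B u then 0 else r T) = 0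
    rw [if_neg h, sub_self]
  have hR₁ : ∀ T, R₁ T ≠ 0 → r T ≠ 0 ∧ ¬ ∃ u, T.1 = cst B u := by
    intro T hT
    by_cases h : ∃ u, T.1 = cst B u
    · exact (hT (if_pos h)).elim
    · refine ⟨fun h0 => hT ?_, h⟩
      show (if ∃ u, T.1 = cst B u then 0 else r T) = 0
      rw [if_neg h, h0]
  have hR₁snd : ∀ T, R₁ T ≠ 0 → ∃ u, T.2 = cst B u := by
    intro T hT
    obtain ⟨hr0, hnc⟩ := hR₁ T hT
    rcases (hshape T hr0).2 with h | h
    · exact (hnc h).elim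
    · exact h
  let M := N₂ ⊔ cstSupp B
  -- (1) `R₁ ∈ M`: rows gathered to `cst 0`, summing to `marg₀ r` minus a constant vector
  have hR₁M : R₁ ∈ M := by
    -- `R₁ = Σ_u (row at cst u) ⊗ e_{cst u}`
    have hrows : R₁ = ∑ u : ZMod 4, tens B (fun s => R₁ (s, cst B u)) (Pi.single (cst B u) 1) := by
      conv_lhs => rw [← sum_emb₀_row B R₁]
      rw [sum_eq_sum_cst B (fun t => emb₀ B t (fun s => R₁ (s, t)))]
      · rfl
      · intro t ht
        have h0 : (fun s => R₁ (s, t)) = 0 := by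
          funext s
          by_contra hne
          obtain ⟨u, hu⟩ := hR₁snd (s, t) hne
          exact ht ⟨u, hu⟩
        rw [h0, map_zero]
    have hrowsupp : ∀ (u : ZMod 4) (s : Ty B), R₁ (s, cst B u) ≠ 0 → IsRes1 B s :=
      fun u s h => ((hshape _ (hR₁ _ h).1).1).1
    -- each row ⊗ e_{cst u} ≡ row ⊗ e_{cst 0}
    have hshift : ∀ u : ZMod 4, tens B (fun s => R₁ (s, cst B u)) (Pi.single (cst B u) 1) -
        tens B (fun s => R₁ (s, cst B u)) (Pi.single (cst B 0) 1) ∈ M := by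
      intro u
      rw [← tens_sub_right]
      exact gather₀_mem B hD0 (hrowsupp u) u 0
    -- the sum of the rows is `marg₀ r` minus a constant vector
    have hsumrows : ∑ u : ZMod 4, (fun s => R₁ (s, cst B u)) = marg₀ B R₁ := by
      funext s
      rw [Finset.sum_apply, marg₀_apply, sum_eq_sum_cst B (fun t => R₁ (s, t))]
      intro t ht
      by_contra hne
      obtain ⟨u, hu⟩ := hR₁snd (s, t) hne
      exact ht ⟨u, hu⟩
    have hc : ∀ s, marg₀ B R₀ s ≠ 0 → ∃ u, s = cst B u := by
      intro s hs
      rw [marg₀_apply] at hs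
      obtain ⟨t, _, ht⟩ := Finset.exists_ne_zero_of_sum_ne_zero hs
      exact hR₀ (s, t) ht
    have hm : marg₀ B R₁ = marg₀ B r - marg₀ B R₀ := by
      have : r = R₀ + R₁ := by show r = (r - R₁) + R₁; abel
      conv_rhs => rw [this, map_add]
      abel
    have hV : tens B (marg₀ B R₁) (Pi.single (cst B 0) 1) ∈ M := by
      rw [hm, tens_sub_left]
      refine Submodule.sub_mem _ ?_ (Submodule.mem_sup_right (tens_mem_cstSupp_left B hc 0))
      refine slice₀_mem B h3 hP (fun u b => hX0 u b 0) (fun u => hW0 u 0) hD0 ((mem_hodge₂_iff B r).mp hr).1 ?_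
      intro s hs
      rw [marg₀_apply] at hs
      obtain ⟨t, _, ht⟩ := Finset.exists_ne_zero_of_sum_ne_zero hs
      exact ((hshape (s, t) ht).1).1
    have e : R₁ = ∑ u : ZMod 4, (tens B (fun s => R₁ (s, cst B u)) (Pi.single (cst B u) 1) -
        tens B (fun s => R₁ (s, cst B u)) (Pi.single (cst B 0) 1)) + tens B (marg₀ B R₁) (Pi.single (cst B 0) 1) := by
      rw [Finset.sum_sub_distrib, ← tens_sum_left, hsumrows, sub_add_cancel]
      exact hrows
    rw [e]
    exact Submodule.add_mem _ (Submodule.sum_mem _ fun u _ => hshift u) hV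
  -- (2) `R₀ ∈ M`: columns gathered to `cst 0`, summing to `marg₁ r` minus a constant vector
  have hR₀M : R₀ ∈ M := by
    have hcols : R₀ = ∑ u : ZMod 4, tens B (Pi.single (cst B u) 1) (fun t => R₀ (cst B u, t)) := by
      conv_lhs => rw [← sum_emb₁_col B R₀]
      rw [sum_eq_sum_cst B (fun s => emb₁ B s (fun t => R₀ (s, t)))]
      · rfl
      · intro s hs
        have h0 : (fun t => R₀ (s, t)) = 0 := by
          funext t
          by_contra hne
          exact hs (hR₀ (s, t) hne)
        rw [h0, map_zero]
    have hcolsupp : ∀ (u : ZMod 4) (t : Ty B), R₀ (cst B u, t) ≠ 0 → IsRes1 B t := by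
      intro u t h
      have hr0 : r (cst B u, t) ≠ 0 := by
        intro h0
        apply h
        show r (cst B u, t) - (if ∃ u', (cst B u, t).1 = cst B u' then 0 else r (cst B u, t)) = 0
        rw [h0, if_pos ⟨u, rfl⟩, sub_zero]
      exact ((hshape _ hr0).1).2
    have hshift : ∀ u : ZMod 4, tens B (Pi.single (cst B u) 1) (fun t => R₀ (cst B u, t)) -
        tens B (Pi.single (cst B 0) 1) (fun t => R₀ (cst B u, t)) ∈ M := by
      intro u
      rw [← tens_sub_left]
      exact gather₁_mem B hD1 (hcolsupp u) u 0
    have hsumcols : ∑ u : ZMod 4, (fun t => R₀ (cst B u, t)) = marg₁ B R₀ := by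
      funext t
      rw [Finset.sum_apply, marg₁_apply, sum_eq_sum_cst B (fun s => R₀ (s, t))]
      intro s hs
      by_contra hne
      exact hs (hR₀ (s, t) hne)
    have hc : ∀ t, marg₁ B R₁ t ≠ 0 → ∃ u, t = cst B u := by
      intro t ht
      rw [marg₁_apply] at ht
      obtain ⟨s, _, hs⟩ := Finset.exists_ne_zero_of_sum_ne_zero ht
      exact hR₁snd (s, t) hs
    have hm : marg₁ B R₀ = marg₁ B r - marg₁ B R₁ := by
      show marg₁ B (r - R₁) = _
      rw [map_sub]
    have hW : tens B (Pi.single (cst B 0) 1) (marg₁ B R₀) ∈ M := by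
      rw [hm, tens_sub_right]
      refine Submodule.sub_mem _ ?_ (Submodule.mem_sup_right (tens_mem_cstSupp_right B hc 0))
      refine slice₁_mem B h3 hP (fun u b => hX1 u b 0) (fun u => hW1 u 0) hD1 ((mem_hodge₂_iff B r).mp hr).2 ?_
      intro t ht
      rw [marg₁_apply] at ht
      obtain ⟨s, _, hs⟩ := Finset.exists_ne_zero_of_sum_ne_zero ht
      exact ((hshape (s, t) hs).1).2
    have tens_sum_right : ∀ (f : ZMod 4 → Ty B → ℤ) (v : Ty B → ℤ),
        tens B v (∑ i : ZMod 4, f i) = ∑ i : ZMod 4, tens B v (f i) := by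
      intro f v
      funext T
      rw [Finset.sum_apply]
      show v T.1 * (∑ i, f i) T.2 = ∑ i, v T.1 * f i T.2
      rw [Finset.sum_apply, Finset.mul_sum]
    have e : R₀ = ∑ u : ZMod 4, (tens B (Pi.single (cst B u) 1) (fun t => R₀ (cst B u, t)) -
        tens B (Pi.single (cst B 0) 1) (fun t => R₀ (cst B u, t))) + tens B (Pi.single (cst B 0) 1) (marg₁ B R₀) := by
      rw [Finset.sum_sub_distrib, ← tens_sum_right, hsumcols, sub_add_cancel]
      exact hcols
    rw [e]
    exact Submodule.add_mem _ (Submodule.sum_mem _ fun u _ => hshift u) hW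
  -- (3) `r ∈ M = N₂ ⊔ cstSupp`, and the constant-constant part is Hodge, hence in `N₂` by `cc_mem`
  have hrM : r ∈ M := by
    have : r = R₀ + R₁ := by show r = (r - R₁) + R₁; abel
    rw [this]
    exact Submodule.add_mem _ hR₀M hR₁M
  obtain ⟨n, hn, c, hc, hnc⟩ := Submodule.mem_sup.mp hrM
  have hcH : c ∈ hodge₂ B := by
    have : c = r - n := by rw [← hnc]; abel
    rw [this]
    exact Submodule.sub_mem _ hr (hN hn)
  have hQ : ∀ a a' : ZMod 4,
      tens B (Pi.single (cst B a) 1 - Pi.single (cst B 0) 1) (Pi.single (cst B a') 1 - Pi.single (cst B 0) 1) ∈ N₂ :=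
    fun a a' => ccSquare₀_mem B a' 0 (fun v => ccSquare_mem B v a' 0 (hW0 v a') (hW0 v 0)
      (fun b => hD0 v b (-1) a' 0 (Or.inr rfl))) a
  have hcN : c ∈ N₂ := cc_mem B hP hQ hcH hc
  rw [← hnc]
  exact Submodule.add_mem _ hn hcN

end Summit.HodgeConjecture.CorCM.Census.OcticTwist
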